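import Summits.Langlands.Langlands.Theses.CompatibleFamilySplit

/-!
# Birth skeleton (BC3) for crux stmt-Langlands-18968
`Summit.Langlands.Langlands.Theses.CompatibleFamilySplit.CompatibleFamilyAutomorphy` — line `birth`

Route `route-Langlands-CompatibleFamilySplit` (crux rank 2: AUTOMORPHY OF COMPATIBLE FAMILIES, the
implication (WCS) ⇒ (AF) of Taylor's ICM diagram, cuspidal form). The crux: for every number field `K`,
`n ≥ 1`, every Satake family `a : places(K) → Multiset ℂ`, every IRREDUCIBLE a.e.-unramified
pinned-de-Rham `ρ₀ : Γ_K → GL_n(ℚ̄_ℓ₀)` reading `a` through `ι₀` a.e., IF `a` carries at EVERY `(ℓ, ι)` a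
semisimple a.e.-unramified pinned-de-Rham member reading `a` through `ι` a.e., THEN `a` is, off finitely
many places, the Satake family of an L-algebraic cuspidal `π` of `GL_n(𝔸_K)`.

The line `birth` is the route's own Layer-2 plan for this crux (route header, TWO-LAYER PLAN:
`CompatibleFamilyAutomorphy ⇐ ResidualAnchor → FamilyLifting`), i.e. Dieulefait's FAMILY SWITCH =
the Wiles / Khare–Wintenberger architecture run inside the family at a prime OF ONE'S CHOICE:

* `stub_residualAnchor` — **A RESIDUALLY AUTOMORPHIC PRIME EXISTS** (Serre-type statement for the
  family; open in general): under the crux hypotheses there are SOME prime `ℓ₁`, `ι₁ : ℚ̄_ℓ₁ ≃ ℂ` and an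
  L-algebraic CUSPIDAL `π₁` of `GL_n(𝔸_K)` whose `ι₁`-arithmetic-Frobenius polynomials
  `arithFrobPolyOfSatake ι₁ q_v 1 β_v` (`β_v` the Satake parameter of `π₁` at `v`) are `ℓ₁`-INTEGRAL and
  CONGRUENT modulo the maximal ideal of `ℤ̄_ℓ₁` (coefficientwise `‖·‖ ≤ 1`, `‖· - ·‖ < 1` for Mathlib's
  spectral `ℓ₁`-adic norm on `PadicAlgCl ℓ₁`) to the family's `arithFrobPolyOfSatake ι₁ q_v 1 (a v)` at
  all but finitely many `v`. By Chebotarev + Brauer–Nesbitt this is `ρ̄₁^ss ≅ ρ̄_{π₁,ι₁}^ss` for the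
  `ℓ₁`-adic member `ρ₁` whenever `π₁` has an `ℓ₁`-adic avatar — residual automorphy at the member
  `(ℓ₁, ι₁)`, typed at the Satake level so that no Galois representation of `π₁` is presupposed. The
  prime is FREE: Langlands–Tunnell-type accidents at `ℓ₁ = 3`, parity-blind `ℓ₁ = 2`, Serre /
  Khare–Wintenberger at a chosen prime, Eisenstein congruences, adequate residual image at a density-one
  set of primes (Larsen). Why it might fail: no residual automorphy engine for `GL_n(𝔽_ℓ)`, `n ≥ 3`
  (no Langlands–Tunnell, Serre's conjecture open beyond `GL₂/ℚ`); even Artin families.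
* `stub_familyLifting` — **AUTOMORPHY LIFTING ALONG THE FAMILY** (R = T at the anchored member; open
  core = irregular / residually small members): under the crux hypotheses, a residual anchor
  `(ℓ₁, ι₁, π₁)` as above forces the family to be the a.e. Satake family of an L-algebraic cuspidal `π`.
  Known sectors: GL₂/ℚ odd (Wiles, Taylor–Wiles, Skinner–Wiles, Kisin 2009 + Khare–Wintenberger 2009),
  regular polarizable adequate Fontaine–Laffaille / potentially diagonalizable members over CM or
  totally real `K` (BLGGT 2014 Thm. 4.2.1, ACC+ 2023 Thm. 6.1.1 — the weight-zero instance is the tree's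
  named fact `ACCGHLNSTT2023.automorphyLifting_crystalline_weightZero`). Why it might fail: regularity,
  Hodge–Tate windows, parity and residual adequacy at `ℓ₁` are NOT supplied by the family hypothesis
  (parity and Hodge–Tate weights are invisible in `a`; refuter briefing on stmt-Langlands-18968) — the
  irregular and residually-small sectors have no patching engine at any prime.
* `CompatibleFamilyAutomorphy_of` — the composition, kernel-checked, concluding the route decl BY NAME:
  anchor (stub 1), then lift (stub 2). The seam is modus ponens (Wiles' shape: residual automorphy ∧
  lifting); neither stub gives the crux or the summit on its own (BC3 probes, NOTES.md of the
  registering session: `stub → CompatibleFamilyAutomorphy` and `stub → Langlands` by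
  `first | exact? | simpa | aesop` fail 4/4).

Both stubs are NECESSARY for the crux in context: the crux gives `stub_familyLifting` by weakening, and
gives `stub_residualAnchor` with `π₁ := π`, `β := a v` (congruence `0 < 1`; integrality of the family's
polynomials a.e. from the compact image of the `ℓ₁`-adic member, `exists_integralModel`). So the split
loses nothing.

Disproof used: none on file (`ledger crux ls stmt-Langlands-18968`: no `Disproof.lean`, no `Negative/`
lemma, no crux idea, 2026-08-17). Negatives index (`ledger negatives --problem Langlands`, 3 entries):
no stub is a refuted statement or a rewording of one. Degeneracies: `n = 0` excluded (`0 < n`) in both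
stubs as in the crux; the trivial family (`n = 1`, `a ≡ {1}`) inhabits the crux (planner BC5,
`special.lean` on the item) and is its own anchor.

Shape (for `ledger skeleton check`): stubs `theorem stub_<name> : <signature> := by sorry` stated over
tree declarations only (fully qualified, as in the route file); `_Goal.stub_<name> : Prop :=
type_of% @stub_<name>` names each statement; `CompatibleFamilyAutomorphy_of
(hA : _Goal.stub_residualAnchor) (hL : _Goal.stub_familyLifting) : CompatibleFamilyAutomorphy` is proved
without `sorry`.
-/

set_option linter.dupNamespace false
set_option linter.unusedVariables false

noncomputable section

namespace Summit.Langlands.Langlands.Cruxes.CompatibleFamilyAutomorphy.Birth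

open Summit.Langlands.Langlands.Theses.CompatibleFamilySplit

/-! ## 1. The two stubs -/

/-- **STUB 1 — RESIDUAL ANCHOR: the family is residually automorphic at SOME prime (open).**
For a number field `K`, `n ≥ 1`, a Satake family `a`, an irreducible a.e.-unramified pinned-de-Rham
`ρ₀ : Γ_K → GL_n(ℚ̄_ℓ₀)` reading `a` through `ι₀` a.e., and a semisimple a.e.-unramified pinned-de-Rham
member reading `a` at EVERY `(ℓ, ι)` (the crux hypotheses, verbatim), there are a prime `ℓ₁`,
`ι₁ : ℚ̄_ℓ₁ ≃ ℂ` and an L-algebraic CUSPIDAL `π₁` of `GL_n(𝔸_K)` such that at all but finitely many `v`,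
`π₁` has a Satake parameter `β` at `v` whose arithmetic-Frobenius polynomial
`arithFrobPolyOfSatake ι₁ q_v 1 β ∈ ℚ̄_ℓ₁[X]` has `ℓ₁`-integral coefficients congruent modulo the maximal
ideal of `ℤ̄_ℓ₁` to those of the family's `arithFrobPolyOfSatake ι₁ q_v 1 (a v)` (Mathlib's spectral norm
on `PadicAlgCl ℓ₁`: `‖·‖ ≤ 1` and `‖· - ·‖ < 1`). Content: residual automorphy `ρ̄₁^ss ≅ ρ̄_{π₁,ι₁}^ss`
of the `ℓ₁`-adic member at a prime of one's choice (Chebotarev + Brauer–Nesbitt turn the a.e.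
congruence of characteristic polynomials into an isomorphism of semisimplified reductions), typed at
the Satake level. Engines: Serre's conjecture / Khare–Wintenberger at a chosen prime (GL₂/ℚ odd),
Langlands–Tunnell at `3`, Eisenstein congruences, the parity-blind prime `2`; open for `GL_n(𝔽_ℓ)`,
`n ≥ 3`, and for even families.
[cite: KhareWintenberger2009, Thm. 1.2] [cite: Dieulefait2004, §3 (switching primes inside the family)]
[cite: TaylorGaloisRepresentations2004, §5 (diagram (WCS) ⇒ (AF))] [cite: Larsen1995, Thm. 3.17] -/
theorem stub_residualAnchor :
    ∀ (K : Type) [Field K] [NumberField K] (n : ℕ)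
      (hcpt : Literature.NumberTheory.Automorphic.isCompact_glFiniteIntegralLevel n K), 0 < n →
      ∀ (a : IsDedekindDomain.HeightOneSpectrum (NumberField.RingOfIntegers K) → Multiset ℂ)
        (ℓ₀ : ℕ) [Fact ℓ₀.Prime] (ι₀ : PadicAlgCl ℓ₀ ≃+* ℂ)
        (ρ₀ : Literature.NumberTheory.GaloisRepresentations.FramedGaloisRep K (PadicAlgCl ℓ₀) n),
        ρ₀.toGaloisRep.IsIrreducible →
        ((∀ᶠ v : IsDedekindDomain.HeightOneSpectrum (NumberField.RingOfIntegers K) in Filter.cofinite,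
            ρ₀.IsUnramifiedAt v) ∧
          ∀ (v : IsDedekindDomain.HeightOneSpectrum (NumberField.RingOfIntegers K))
            (hv : ((ℓ₀ : ℕ) : NumberField.RingOfIntegers K) ∈ v.asIdeal),
            (Literature.NumberTheory.PAdicHodge.fontainePstAdicCompletion v ℓ₀ hv).IsDeRhamFramed
              (ρ₀.toLocal v)) →
        (∀ᶠ v : IsDedekindDomain.HeightOneSpectrum (NumberField.RingOfIntegers K) in Filter.cofinite,
          ρ₀.IsUnramifiedAt v ∧ ρ₀.HasFrobCharpolyAt v
            (Literature.NumberTheory.Automorphic.arithFrobPolyOfSatake ι₀ v.residueCard 1 (a v))) →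
        (∀ (ℓ : ℕ) [Fact ℓ.Prime] (ι : PadicAlgCl ℓ ≃+* ℂ),
          ∃ ρ : Literature.NumberTheory.GaloisRepresentations.FramedGaloisRep K (PadicAlgCl ℓ) n,
            ρ.toGaloisRep.IsSemisimple ∧
            ((∀ᶠ v : IsDedekindDomain.HeightOneSpectrum (NumberField.RingOfIntegers K) in Filter.cofinite,
                ρ.IsUnramifiedAt v) ∧
              ∀ (v : IsDedekindDomain.HeightOneSpectrum (NumberField.RingOfIntegers K))
                (hv : ((ℓ : ℕ) : NumberField.RingOfIntegers K) ∈ v.asIdeal),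
                (Literature.NumberTheory.PAdicHodge.fontainePstAdicCompletion v ℓ hv).IsDeRhamFramed
                  (ρ.toLocal v)) ∧
            (∀ᶠ v : IsDedekindDomain.HeightOneSpectrum (NumberField.RingOfIntegers K) in Filter.cofinite,
              ρ.IsUnramifiedAt v ∧ ρ.HasFrobCharpolyAt v
                (Literature.NumberTheory.Automorphic.arithFrobPolyOfSatake ι v.residueCard 1 (a v)))) →
        ∃ (ℓ₁ : ℕ) (_ : Fact ℓ₁.Prime) (ι₁ : PadicAlgCl ℓ₁ ≃+* ℂ)
          (π₁ : Literature.NumberTheory.Automorphic.CuspidalAutomorphicRepData n K hcpt),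
          π₁.1.IsLAlgebraic ∧
          ∀ᶠ v : IsDedekindDomain.HeightOneSpectrum (NumberField.RingOfIntegers K) in Filter.cofinite,
            ∃ β : Multiset ℂ, π₁.1.HasSatakeParamAt v β ∧
              ∀ k : ℕ,
                ‖(Literature.NumberTheory.Automorphic.arithFrobPolyOfSatake ι₁ v.residueCard 1 β).coeff k‖
                    ≤ 1 ∧
                ‖(Literature.NumberTheory.Automorphic.arithFrobPolyOfSatake ι₁ v.residueCard 1 β).coeff k -
                    (Literature.NumberTheory.Automorphic.arithFrobPolyOfSatake ι₁ v.residueCard 1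
                      (a v)).coeff k‖ < 1 := by
  sorry

/-- **STUB 2 — FAMILY LIFTING: a residually automorphic anchor forces automorphy of the family (open
core; known in the regular adequate sectors).**
For `K`, `n ≥ 1`, `a`, `ρ₀`, members at every `(ℓ, ι)` as in the crux, and ANY prime `ℓ₁`,
`ι₁ : ℚ̄_ℓ₁ ≃ ℂ` and L-algebraic cuspidal `π₁` of `GL_n(𝔸_K)` whose `ι₁`-arithmetic-Frobenius
polynomials are `ℓ₁`-integral and congruent modulo the maximal ideal of `ℤ̄_ℓ₁` to the family's at all
but finitely many places (a residual anchor at `(ℓ₁, ι₁)`, the conclusion of `stub_residualAnchor`),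
the family `a` is, off finitely many places, the Satake family of an L-algebraic CUSPIDAL `π` of
`GL_n(𝔸_K)`. Content: automorphy lifting (`R = T`) applied to the `ℓ₁`-adic member `ρ₁`, residually
automorphic by the anchor; the conclusion is read back on the whole family through `a`. Known sectors:
GL₂/ℚ odd at every prime (Wiles–Taylor–Wiles, Skinner–Wiles, Kisin 2009 with Khare–Wintenberger 2009);
regular, polarizable, residually adequate, potentially diagonalizable members over CM / totally real `K`
(BLGGT 2014 Thm. 4.2.1); Fontaine–Laffaille regular members with enormous decomposed-generic residual
image over CM `K` without polarization (ACC+ 2023 Thm. 6.1.1; weight zero vendored as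
`ACCGHLNSTT2023.automorphyLifting_crystalline_weightZero`). Open core: irregular members (no
Hodge–Tate regularity is readable off `a`), residually small / inadequate image at `ℓ₁`, `K` neither
CM nor totally real; irreducibility of the member `ρ₁` (known only for a density-one set of primes in
the regular polarizable case, Patrikis–Taylor) is part of the stub.
[cite: Kisin2009, Thm. (main theorem, potentially Barsotti–Tate lifting)]
[cite: KhareWintenberger2009, Thm. 1.2] [cite: BarnetlambEtAl2014, Thm. 4.2.1]
[cite: ACCGHLNSTT2023, Thm. 6.1.1] [cite: PatrikisTaylor2014, Thm. A] -/
theorem stub_familyLifting :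
    ∀ (K : Type) [Field K] [NumberField K] (n : ℕ)
      (hcpt : Literature.NumberTheory.Automorphic.isCompact_glFiniteIntegralLevel n K), 0 < n →
      ∀ (a : IsDedekindDomain.HeightOneSpectrum (NumberField.RingOfIntegers K) → Multiset ℂ)
        (ℓ₀ : ℕ) [Fact ℓ₀.Prime] (ι₀ : PadicAlgCl ℓ₀ ≃+* ℂ)
        (ρ₀ : Literature.NumberTheory.GaloisRepresentations.FramedGaloisRep K (PadicAlgCl ℓ₀) n),
        ρ₀.toGaloisRep.IsIrreducible →
        ((∀ᶠ v : IsDedekindDomain.HeightOneSpectrum (NumberField.RingOfIntegers K) in Filter.cofinite,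
            ρ₀.IsUnramifiedAt v) ∧
          ∀ (v : IsDedekindDomain.HeightOneSpectrum (NumberField.RingOfIntegers K))
            (hv : ((ℓ₀ : ℕ) : NumberField.RingOfIntegers K) ∈ v.asIdeal),
            (Literature.NumberTheory.PAdicHodge.fontainePstAdicCompletion v ℓ₀ hv).IsDeRhamFramed
              (ρ₀.toLocal v)) →
        (∀ᶠ v : IsDedekindDomain.HeightOneSpectrum (NumberField.RingOfIntegers K) in Filter.cofinite,
          ρ₀.IsUnramifiedAt v ∧ ρ₀.HasFrobCharpolyAt v
            (Literature.NumberTheory.Automorphic.arithFrobPolyOfSatake ι₀ v.residueCard 1 (a v))) →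
        (∀ (ℓ : ℕ) [Fact ℓ.Prime] (ι : PadicAlgCl ℓ ≃+* ℂ),
          ∃ ρ : Literature.NumberTheory.GaloisRepresentations.FramedGaloisRep K (PadicAlgCl ℓ) n,
            ρ.toGaloisRep.IsSemisimple ∧
            ((∀ᶠ v : IsDedekindDomain.HeightOneSpectrum (NumberField.RingOfIntegers K) in Filter.cofinite,
                ρ.IsUnramifiedAt v) ∧
              ∀ (v : IsDedekindDomain.HeightOneSpectrum (NumberField.RingOfIntegers K))
                (hv : ((ℓ : ℕ) : NumberField.RingOfIntegers K) ∈ v.asIdeal),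
                (Literature.NumberTheory.PAdicHodge.fontainePstAdicCompletion v ℓ hv).IsDeRhamFramed
                  (ρ.toLocal v)) ∧
            (∀ᶠ v : IsDedekindDomain.HeightOneSpectrum (NumberField.RingOfIntegers K) in Filter.cofinite,
              ρ.IsUnramifiedAt v ∧ ρ.HasFrobCharpolyAt v
                (Literature.NumberTheory.Automorphic.arithFrobPolyOfSatake ι v.residueCard 1 (a v)))) →
        ∀ (ℓ₁ : ℕ) [Fact ℓ₁.Prime] (ι₁ : PadicAlgCl ℓ₁ ≃+* ℂ)
          (π₁ : Literature.NumberTheory.Automorphic.CuspidalAutomorphicRepData n K hcpt),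
          π₁.1.IsLAlgebraic →
          (∀ᶠ v : IsDedekindDomain.HeightOneSpectrum (NumberField.RingOfIntegers K) in Filter.cofinite,
            ∃ β : Multiset ℂ, π₁.1.HasSatakeParamAt v β ∧
              ∀ k : ℕ,
                ‖(Literature.NumberTheory.Automorphic.arithFrobPolyOfSatake ι₁ v.residueCard 1 β).coeff k‖
                    ≤ 1 ∧
                ‖(Literature.NumberTheory.Automorphic.arithFrobPolyOfSatake ι₁ v.residueCard 1 β).coeff k -
                    (Literature.NumberTheory.Automorphic.arithFrobPolyOfSatake ι₁ v.residueCard 1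
                      (a v)).coeff k‖ < 1) →
          ∃ π : Literature.NumberTheory.Automorphic.CuspidalAutomorphicRepData n K hcpt,
            π.1.IsLAlgebraic ∧
            ∀ᶠ v : IsDedekindDomain.HeightOneSpectrum (NumberField.RingOfIntegers K) in Filter.cofinite,
              π.1.HasSatakeParamAt v (a v) := by
  sorry

/-! ## 2. The stub statements as named `Prop`s (literally their types) -/

namespace _Goal

/-- The statement of `stub_residualAnchor`, as a named `Prop` (literally its type). [folklore] -/
def stub_residualAnchor : Prop :=
  type_of% @Summit.Langlands.Langlands.Cruxes.CompatibleFamilyAutomorphy.Birth.stub_residualAnchor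

/-- The statement of `stub_familyLifting`, as a named `Prop` (literally its type). [folklore] -/
def stub_familyLifting : Prop :=
  type_of% @Summit.Langlands.Langlands.Cruxes.CompatibleFamilyAutomorphy.Birth.stub_familyLifting

end _Goal

/-! ## 3. The composition (kernel-checked, no `sorry`): ANCHOR at a free prime → LIFT along the family -/

/-- **`CompatibleFamilyAutomorphy` from the two stubs.** Given the crux data `K, n, hcpt, a, ℓ₀, ι₀, ρ₀`
with its four hypotheses (irreducible; a.e. unramified and pinned de Rham; reads `a` through `ι₀`;
members at every `(ℓ, ι)`): `stub_residualAnchor` supplies a prime `ℓ₁`, `ι₁` and an L-algebraic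
cuspidal `π₁` congruent to the family modulo the maximal ideal of `ℤ̄_ℓ₁` a.e.; `stub_familyLifting`, fed
with the same data and that anchor, supplies the L-algebraic cuspidal `π` with Satake family `a` a.e.
The hypotheses are, by name, the statements of the two stubs; the conclusion is the route decl
`Summit.Langlands.Langlands.Theses.CompatibleFamilySplit.CompatibleFamilyAutomorphy`. [folklore] -/
theorem CompatibleFamilyAutomorphy_of (hA : _Goal.stub_residualAnchor) (hL : _Goal.stub_familyLifting) :
    Summit.Langlands.Langlands.Theses.CompatibleFamilySplit.CompatibleFamilyAutomorphy := by
  -- the stub statements, as the Π-types they literally are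
  have hA' : type_of% @stub_residualAnchor := hA
  have hL' : type_of% @stub_familyLifting := hL
  intro K _ _ n hcpt hn a ℓ₀ _ ι₀ ρ₀ hirr hgeo hread hfam
  -- ANCHOR: a residually automorphic prime `ℓ₁` (with `ι₁`, `π₁`)
  obtain ⟨ℓ₁, hℓ₁, ι₁, π₁, hLalg, hcong⟩ := hA' K n hcpt hn a ℓ₀ ι₀ ρ₀ hirr hgeo hread hfam
  -- LIFT along the family from the anchored member `(ℓ₁, ι₁)`
  exact hL' K n hcpt hn a ℓ₀ ι₀ ρ₀ hirr hgeo hread hfam ℓ₁ ι₁ π₁ hLalg hcong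

/-- By-name sanity check (an `example`, not a declaration of the file): the two stubs feed the
composition as they stand. -/
example : Summit.Langlands.Langlands.Theses.CompatibleFamilySplit.CompatibleFamilyAutomorphy :=
  CompatibleFamilyAutomorphy_of stub_residualAnchor stub_familyLifting

end Summit.Langlands.Langlands.Cruxes.CompatibleFamilyAutomorphy.Birth

end
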